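import Mathlib
import HarnessLib

/-!
# `OddSector.OddBartaFloor` (stmt-RiemannHypothesis-17779): finite-dimensional models of the Barta mechanism

Companion of `Negative/OddBartaFloorLoadBearing.lean` (standing disprover, cycle 1). The route
OddSector intends to prove the crux `OddBartaFloor` by BARTA'S INEQUALITY: the odd theta vector
`H_a = -Φ′𝟙_{[-a,a]}` is a positive pointwise supersolution, `A_a H_a ≥ -e(a) H_a` on `(0,a)`, and
pairing it with a ONE-SIGNED odd bottom state `ψ` gives `ε_od(a)⟨ψ,H_a⟩ = ⟨ψ, A_a H_a⟩ ≥ -e(a)⟨ψ,H_a⟩`.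
This file records the mechanism in `ℝⁿ` (`barta_matrix`) and two 2×2 witnesses showing which of
its hypotheses are load-bearing: the SIGN of the bottom state (`barta_false_without_sign`) and the
supersolution inequality on the WHOLE support of the bottom state (`barta_false_without_everywhere`
— an edge/origin layer of `(0,a)` where `T_a ≥ -e H_a` fails is fatal unless the mass of `ψ` there
is controlled, cf. route kill criterion (k2) and 2001 Thm 5.2's layer-mass bound). Small-model
facts only; nothing here mentions a Theses decl.

Reference: J. Barta, *Sur la vibration fondamentale d'une membrane*, C. R. Acad. Sci. Paris 204
(1937) 472–473.
-/

-- D-0017 layout (Sub = Summit) repeats the `RiemannHypothesis` component in every name here.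
set_option linter.dupNamespace false

namespace Summit.RiemannHypothesis.RiemannHypothesis.Theorems.OddBartaFloor.Negative

open Matrix in
/-- **Barta's inequality, finite-dimensional model of the route's mechanism.** For a symmetric
matrix `A`, an eigenpair `A ψ = E ψ` with `ψ ≥ 0`, and a comparison vector `H` with `⟨ψ,H⟩ > 0`
satisfying the supersolution inequality `A H ≥ -e H` componentwise, `E ≥ -e`
(`E⟨ψ,H⟩ = ⟨Aψ,H⟩ = ⟨ψ,AH⟩ ≥ -e⟨ψ,H⟩`). In the route: `A = A_a` on the odd sector, `ψ` the
one-signed odd bottom state, `H = H_a = -Φ′𝟙_{[-a,a]}`, `E = ε_od(a)`.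
(J. Barta, C. R. Acad. Sci. Paris 204 (1937) 472–473.) [folklore] -/
theorem barta_matrix {ι : Type*} [Fintype ι] (A : Matrix ι ι ℝ) (hA : A.IsSymm)
    {ψ H : ι → ℝ} {E e : ℝ} (hψ : A *ᵥ ψ = E • ψ) (hψ0 : ∀ i, 0 ≤ ψ i)
    (hpair : 0 < ψ ⬝ᵥ H) (hsuper : ∀ i, -e * H i ≤ (A *ᵥ H) i) : -e ≤ E := by
  have h1 : ψ ⬝ᵥ (A *ᵥ H) = E * (ψ ⬝ᵥ H) := by
    rw [dotProduct_mulVec, ← mulVec_transpose, hA.eq, hψ, smul_dotProduct, smul_eq_mul]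
  have h2 : -e * (ψ ⬝ᵥ H) ≤ ψ ⬝ᵥ (A *ᵥ H) := by
    simp only [dotProduct, Finset.mul_sum]
    refine Finset.sum_le_sum fun i _ ↦ ?_
    have := mul_le_mul_of_nonneg_left (hsuper i) (hψ0 i)
    linarith
  rw [h1] at h2
  exact le_of_mul_le_mul_right h2 hpair

open Matrix in
/-- **The sign of the bottom state is load-bearing for the mechanism** (2×2 model):
`A = [[1,2],[2,1]]` is symmetric, `H = (1,1) > 0` satisfies `A H = (3,3) ≥ 0 = -0·H`, yet the bottom
eigenvector `ψ = (1,-1)` changes sign and the bottom eigenvalue `E = -1` violates the would-be floor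
`E ≥ -0`. [folklore] -/
theorem barta_false_without_sign :
    ∃ (A : Matrix (Fin 2) (Fin 2) ℝ) (ψ H : Fin 2 → ℝ) (E : ℝ),
      A.IsSymm ∧ A *ᵥ ψ = E • ψ ∧ ψ ≠ 0 ∧ (∀ i, 0 < H i) ∧ (∀ i, -0 * H i ≤ (A *ᵥ H) i) ∧
        E < -0 := by
  refine ⟨!![1, 2; 2, 1], ![1, -1], ![1, 1], -1, ?_, ?_, ?_, ?_, ?_, by norm_num⟩
  · exact Matrix.IsSymm.ext fun i j ↦ by fin_cases i <;> fin_cases j <;> rfl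
  · ext i; fin_cases i <;> simp [Matrix.mulVec, dotProduct, Fin.sum_univ_two] <;> norm_num
  · intro h; simpa using congr_fun h 0
  · intro i; fin_cases i <;> simp
  · intro i; fin_cases i <;> simp [Matrix.mulVec, dotProduct, Fin.sum_univ_two] <;> norm_num

open Matrix in
/-- **The supersolution inequality must hold on the WHOLE support of the bottom state** (2×2
model): `A = [[1,-2],[-2,-2]]` has the ONE-SIGNED bottom eigenvector `ψ = (1,2)`, `E = -3`; the
positive `H = (3,1)` satisfies `(A H)₀ = 1 ≥ 0` but `(A H)₁ = -8`, and `E ≥ -0` fails. In the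
route: an edge or origin layer of `(0,a)` where `T_a ≥ -e H_a` fails is fatal unless the mass of
the bottom state there is controlled separately (2001 Thm 5.2's layer-mass bound; route kill
criterion (k2)). [folklore] -/
theorem barta_false_without_everywhere :
    ∃ (A : Matrix (Fin 2) (Fin 2) ℝ) (ψ H : Fin 2 → ℝ) (E : ℝ),
      A.IsSymm ∧ A *ᵥ ψ = E • ψ ∧ (∀ i, 0 < ψ i) ∧ (∀ i, 0 < H i) ∧
        -0 * H 0 ≤ (A *ᵥ H) 0 ∧ E < -0 := by
  refine ⟨!![1, -2; -2, -2], ![1, 2], ![3, 1], -3, ?_, ?_, ?_, ?_, ?_, by norm_num⟩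
  · exact Matrix.IsSymm.ext fun i j ↦ by fin_cases i <;> fin_cases j <;> rfl
  · ext i; fin_cases i <;> simp [Matrix.mulVec, dotProduct, Fin.sum_univ_two] <;> norm_num
  · intro i; fin_cases i <;> simp
  · intro i; fin_cases i <;> simp
  · simp [Matrix.mulVec, dotProduct, Fin.sum_univ_two]; norm_num

end Summit.RiemannHypothesis.RiemannHypothesis.Theorems.OddBartaFloor.Negative
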